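import Summits.AtomisticToContinuum.BoseEinsteinCondensation.Theorems.BECInsertionCorrectorStaticResponseBoundModulationEulerLagrange
import Literature.MathematicalPhysics.QuantumManyBody.TorusPoincareInequality
import HarnessLib

/-!
# The spectral gap of the ground-state Dirichlet form in the few-body regime
# (stub `stub_weightedGap` of the few-body layer of crux `BECInsertionCorrector.StaticResponseBound`,
# item stmt-AtomisticToContinuum-12057, line `stable-fraction-square-completion`, seat c2)

For a positive real finite-energy minimiser `Φ` of the periodic energy `E_w` over the finite-energy
periodic trial states (value `λ = E_w(Φ)`, `F = |Φ|`, `∫_cell F² = 1`) and a real `C¹` lattice-periodic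
Bose-symmetric test function `η` with `∫ η F² = 0`, the ground-state Dirichlet form
`𝓔_F(η, η) = ∫ |∇η|² F²` has the gap

  `((2π/L)² − 2λ) ∫ η² F² ≤ 𝓔_F(η, η)`                                        (`stub_weightedGap`).

Proof (all integrals real Bochner integrals on the cell `[0,L)^{3N}`):
* `integral_cellN_sq_le_of_isLatticePeriodic` — the torus Poincaré inequality
  `lintegral_cellN_normSq_le` in real form: `∫ g² ≤ (∫ g)²/L^{3N} + (L/2π)² ∫ |∇g|²` for real `C¹`
  lattice-periodic `g` (`|∇g|² = Γ(g,g)`, `kineticDensity_ofReal_eq_gradDot`);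
* `sq_integral_cellN_mul_le` — Cauchy–Schwarz on the cell (discriminant);
* `integral_gradDot_mul_ge` — for `∫F² = 1`, `∫ηF² = 0`: `((2π/L)² − ∫|∇F|²) ∫η²F² ≤ ∫|∇(ηF)|²`
  (Poincaré for `ηF` and for `F`; the mean of `ηF` is estimated by Cauchy–Schwarz against
  `1 − (∫F)·F`: `(∫ηF)² ≤ ∫η²F² · (L^{3N} − (∫F)²) ≤ ∫η²F² · L^{3N}(L/2π)² ∫|∇F|²`);
* `stub_weightedGap` — the unnormalised ground-state representation
  `∫|∇(ηF)|² + ∫Wη²F² = λ∫η²F² + 𝓔_F(η,η)` (`gradDot_mul_self_eq` and the weak Euler–Lagrange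
  equation `eulerLagrange_of_isMinimiser` with `s = 0`, `ζ = η²`), `W ≥ 0` and `∫|∇F|² ≤ λ`.

References: [LiebLoss2001] Thm. 8.11 (Poincaré); [Davies1989] §4.2 (ground-state transform).
-/

noncomputable section

namespace Summit.AtomisticToContinuum.BoseEinsteinCondensation.Cruxes.StaticResponseBound.FewBody

open MeasureTheory Filter
open scoped ENNReal NNReal BigOperators Topology
open Literature.MathematicalPhysics.QuantumManyBody.BoseGas
open Summit.AtomisticToContinuum.BoseEinsteinCondensation.Theses
open Summit.AtomisticToContinuum.BoseEinsteinCondensation.Theses.BECInsertionCorrector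
open Summit.AtomisticToContinuum.BoseEinsteinCondensation.Theorems.StaticResponseBound.Negative
open Summit.AtomisticToContinuum.BoseEinsteinCondensation.Cruxes.StaticResponseBound.UvThomsonForceWave

variable {N : ℕ} {L : ℝ}

/-! ### The torus Poincaré inequality in real form -/

/-- **Torus Poincaré inequality, real form.** For a real `C¹` function `g` on `(ℝ³)^N` that is
`Lℤ³`-periodic in every particle,
`∫_cell g² ≤ (∫_cell g)² / L^{3N} + (L/2π)² ∫_cell |∇g|²`
(`lintegral_cellN_normSq_le` for `g` viewed as a complex function: `ĉ₀(g) = L^{-3N} ∫ g`,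
`|∇g|² = Γ(g, g)`).
[cite: LiebLoss2001, §7.9 and Thm. 8.11 (Fourier characterisation of the kinetic energy; Poincaré inequality)] -/
theorem integral_cellN_sq_le_of_isLatticePeriodic (hL : 0 < L) {g : Config N → ℝ}
    (hg : ContDiff ℝ 1 g) (hper : IsLatticePeriodic L g) :
    ∫ X in cellN N L, g X ^ 2 ≤ ((L ^ 3) ^ N)⁻¹ * (∫ X in cellN N L, g X) ^ 2 +
      (L / (2 * Real.pi)) ^ 2 * ∫ X in cellN N L, gradDot g g X := by
  have hG : ContDiff ℝ 1 fun X => ((g X : ℝ) : ℂ) := Complex.ofRealCLM.contDiff.comp hg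
  have hGper : IsTorusPeriodic L fun X => ((g X : ℝ) : ℂ) := fun X i k => by
    simp only [hper X i k]
  have h := lintegral_cellN_normSq_le hL hG hGper
  have hK0 : 0 ≤ ∫ X in cellN N L, gradDot g g X := integral_nonneg fun X => gradDot_self_nonneg g X
  have hV0 : 0 ≤ (L ^ 3) ^ N := pow_nonneg (pow_nonneg hL.le 3) N
  have ig2 : IntegrableOn (fun X => g X ^ 2) (cellN N L) := integrableOn_cellN (hg.continuous.pow 2) L
  have e1 : ∫⁻ X in cellN N L, ((‖((g X : ℝ) : ℂ)‖₊ : ℝ≥0∞)) ^ 2 =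
      ENNReal.ofReal (∫ X in cellN N L, g X ^ 2) := by
    rw [ofReal_integral_eq_lintegral_ofReal ig2 (ae_of_all _ fun X => sq_nonneg (g X))]
    refine lintegral_congr fun X => ?_
    rw [coe_nnnorm_sq_eq_ofReal, Complex.norm_real, Real.norm_eq_abs, sq_abs]
  have e2 : ∫⁻ X in cellN N L, kineticDensity (fun Y => ((g Y : ℝ) : ℂ)) X =
      ENNReal.ofReal (∫ X in cellN N L, gradDot g g X) := by
    rw [ofReal_integral_eq_lintegral_ofReal (integrableOn_cellN (continuous_gradDot hg hg) L)
      (ae_of_all _ fun X => gradDot_self_nonneg g X)]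
    exact lintegral_congr fun X => kineticDensity_ofReal_eq_gradDot (hg.differentiable one_ne_zero) X
  have e3 : configFourierCoeff L (fun Y => ((g Y : ℝ) : ℂ)) 0 =
      ((((L ^ 3)⁻¹) ^ N * ∫ X in cellN N L, g X : ℝ) : ℂ) := by
    rw [configFourierCoeff_zero hL hG.continuous.aestronglyMeasurable, integral_complex_ofReal,
      Complex.real_smul, Complex.ofReal_mul]
  have e4 : ((‖configFourierCoeff L (fun Y => ((g Y : ℝ) : ℂ)) 0‖₊ : ℝ≥0∞)) ^ 2 =
      ENNReal.ofReal ((((L ^ 3)⁻¹) ^ N * ∫ X in cellN N L, g X) ^ 2) := by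
    rw [coe_nnnorm_sq_eq_ofReal, e3, Complex.norm_real, Real.norm_eq_abs, sq_abs]
  have e5 : (ENNReal.ofReal L ^ 3) ^ N = ENNReal.ofReal ((L ^ 3) ^ N) := by
    rw [← ENNReal.ofReal_pow hL.le, ← ENNReal.ofReal_pow (pow_nonneg hL.le 3)]
  rw [e1, e2, e4, e5, ← ENNReal.ofReal_mul hV0, ← ENNReal.ofReal_mul (sq_nonneg _),
    ← ENNReal.ofReal_add (mul_nonneg hV0 (sq_nonneg _)) (mul_nonneg (sq_nonneg _) hK0),
    ENNReal.ofReal_le_ofReal_iff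
      (add_nonneg (mul_nonneg hV0 (sq_nonneg _)) (mul_nonneg (sq_nonneg _) hK0))] at h
  have hV : (L ^ 3) ^ N ≠ 0 := pow_ne_zero _ (pow_ne_zero _ hL.ne')
  calc ∫ X in cellN N L, g X ^ 2
      ≤ (L ^ 3) ^ N * (((L ^ 3)⁻¹) ^ N * ∫ X in cellN N L, g X) ^ 2 +
          (L / (2 * Real.pi)) ^ 2 * ∫ X in cellN N L, gradDot g g X := h
    _ = ((L ^ 3) ^ N)⁻¹ * (∫ X in cellN N L, g X) ^ 2 +
          (L / (2 * Real.pi)) ^ 2 * ∫ X in cellN N L, gradDot g g X := by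
        rw [inv_pow]
        field_simp

/-! ### Cauchy–Schwarz on the cell -/

/-- **Cauchy–Schwarz for real integrals of continuous functions on the cell**:
`(∫ φψ)² ≤ (∫ φ²)(∫ ψ²)` (the discriminant of `t ↦ ∫ (tφ + ψ)² ≥ 0`). [folklore] -/
theorem sq_integral_cellN_mul_le {φ ψ : Config N → ℝ} (hφ : Continuous φ) (hψ : Continuous ψ)
    (L : ℝ) :
    (∫ X in cellN N L, φ X * ψ X) ^ 2 ≤
      (∫ X in cellN N L, φ X ^ 2) * ∫ X in cellN N L, ψ X ^ 2 := by
  have i1 : IntegrableOn (fun X => φ X ^ 2) (cellN N L) := integrableOn_cellN (hφ.pow 2) L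
  have i2 : IntegrableOn (fun X => φ X * ψ X) (cellN N L) := integrableOn_cellN (hφ.mul hψ) L
  have i3 : IntegrableOn (fun X => ψ X ^ 2) (cellN N L) := integrableOn_cellN (hψ.pow 2) L
  have hq : ∀ t : ℝ, 0 ≤ (∫ X in cellN N L, φ X ^ 2) * (t * t) +
      (2 * ∫ X in cellN N L, φ X * ψ X) * t + ∫ X in cellN N L, ψ X ^ 2 := by
    intro t
    have h0 : 0 ≤ ∫ X in cellN N L, (t * φ X + ψ X) ^ 2 := integral_nonneg fun X => sq_nonneg _
    have hpt : ∀ X, (t * φ X + ψ X) ^ 2 = t * t * φ X ^ 2 + 2 * t * (φ X * ψ X) + ψ X ^ 2 :=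
      fun X => by ring
    simp_rw [hpt] at h0
    have iA : Integrable (fun X => t * t * φ X ^ 2 + 2 * t * (φ X * ψ X))
        (volume.restrict (cellN N L)) := (i1.const_mul _).add (i2.const_mul _)
    rw [integral_add iA i3, integral_add (i1.const_mul _) (i2.const_mul _), integral_const_mul,
      integral_const_mul] at h0
    linarith
  have hd := discrim_le_zero hq
  rw [discrim] at hd
  nlinarith [hd]

/-! ### The Poincaré–Cauchy–Schwarz core -/

/-- **Core of the weighted gap.** For real `C¹` lattice-periodic `F`, `η` with `∫_cell F² = 1` and
`∫_cell η F² = 0`: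
`((2π/L)² − ∫|∇F|²) · ∫ η²F² ≤ ∫ |∇(ηF)|²`.
Torus Poincaré for `ηF` and for `F`; since `ηF ⊥ F` in `L²(cell)`, the mean of `ηF` is its pairing with
`1 − (∫F)·F`, so by Cauchy–Schwarz `(∫ηF)² ≤ ∫η²F² · (L^{3N} − (∫F)²)`, and
`1 − (∫F)²/L^{3N} ≤ (L/2π)² ∫|∇F|²` by Poincaré for `F`. [folklore] -/
theorem integral_gradDot_mul_ge (hL : 0 < L) {F η : Config N → ℝ} (hF : ContDiff ℝ 1 F)
    (hFper : IsLatticePeriodic L F) (hη : ContDiff ℝ 1 η) (hηper : IsLatticePeriodic L η)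
    (hF1 : ∫ X in cellN N L, F X ^ 2 = 1) (horth : ∫ X in cellN N L, η X * F X ^ 2 = 0) :
    ((2 * Real.pi / L) ^ 2 - ∫ X in cellN N L, gradDot F F X) *
        ∫ X in cellN N L, η X ^ 2 * F X ^ 2 ≤
      ∫ X in cellN N L, gradDot (fun Y => η Y * F Y) (fun Y => η Y * F Y) X := by
  have hφC : ContDiff ℝ 1 fun X => η X * F X := hη.mul hF
  have hφper : IsLatticePeriodic L fun X => η X * F X := fun X i a => by
    show η _ * F _ = η X * F X
    rw [hηper X i a, hFper X i a]
  -- integrability on the cell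
  have iF : IntegrableOn F (cellN N L) := integrableOn_cellN hF.continuous L
  have iF2 : IntegrableOn (fun X => F X ^ 2) (cellN N L) :=
    integrableOn_cellN (hF.continuous.pow 2) L
  have iφ : IntegrableOn (fun X => η X * F X) (cellN N L) := integrableOn_cellN hφC.continuous L
  have iηF2 : IntegrableOn (fun X => η X * F X ^ 2) (cellN N L) :=
    integrableOn_cellN (hη.continuous.mul (hF.continuous.pow 2)) L
  have i1 : IntegrableOn (fun _ : Config N => (1 : ℝ)) (cellN N L) :=
    integrableOn_cellN continuous_const L
  -- Poincaré for `ηF` and for `F`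
  have hPφ := integral_cellN_sq_le_of_isLatticePeriodic hL hφC hφper
  have hPF := integral_cellN_sq_le_of_isLatticePeriodic hL hF hFper
  rw [hF1] at hPF
  have hφ2 : ∫ X in cellN N L, (η X * F X) ^ 2 = ∫ X in cellN N L, η X ^ 2 * F X ^ 2 := by
    congr 1 with X
    ring
  rw [hφ2] at hPφ
  -- Cauchy–Schwarz against `1 - (∫F) F`
  have hψc : Continuous fun X => 1 - (∫ Y in cellN N L, F Y) * F X :=
    continuous_const.sub (continuous_const.mul hF.continuous)
  have hCS := sq_integral_cellN_mul_le (φ := fun X => η X * F X) hφC.continuous hψc L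
  have e1 : ∫ X in cellN N L, η X * F X * (1 - (∫ Y in cellN N L, F Y) * F X) =
      ∫ X in cellN N L, η X * F X := by
    have hpt : ∀ X, η X * F X * (1 - (∫ Y in cellN N L, F Y) * F X) =
        η X * F X - (∫ Y in cellN N L, F Y) * (η X * F X ^ 2) := fun X => by ring
    simp_rw [hpt]
    rw [integral_sub iφ (iηF2.const_mul _), integral_const_mul, horth, mul_zero, sub_zero]
  have e2 : ∫ X in cellN N L, (1 - (∫ Y in cellN N L, F Y) * F X) ^ 2 =
      (L ^ 3) ^ N - (∫ Y in cellN N L, F Y) ^ 2 := by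
    have hpt : ∀ X, (1 - (∫ Y in cellN N L, F Y) * F X) ^ 2 =
        (1 + (∫ Y in cellN N L, F Y) ^ 2 * F X ^ 2) - 2 * (∫ Y in cellN N L, F Y) * F X :=
      fun X => by ring
    simp_rw [hpt]
    have iA : Integrable (fun X => (1 : ℝ) + (∫ Y in cellN N L, F Y) ^ 2 * F X ^ 2)
        (volume.restrict (cellN N L)) := i1.add (iF2.const_mul _)
    rw [integral_sub iA (iF.const_mul _), integral_add i1 (iF2.const_mul _), integral_const_mul,
      integral_const_mul, hF1, setIntegral_const, volume_real_cellN hL N, smul_eq_mul]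
    ring
  rw [e1, hφ2, e2] at hCS
  -- abbreviations
  set V : ℝ := (L ^ 3) ^ N with hV
  set c : ℝ := (L / (2 * Real.pi)) ^ 2 with hc
  set A : ℝ := ∫ X in cellN N L, η X ^ 2 * F X ^ 2 with hA
  set K : ℝ := ∫ X in cellN N L, gradDot (fun Y => η Y * F Y) (fun Y => η Y * F Y) X with hK
  set T₀ : ℝ := ∫ X in cellN N L, gradDot F F X with hT₀
  set m : ℝ := ∫ X in cellN N L, η X * F X with hm
  set mF : ℝ := ∫ X in cellN N L, F X with hmF
  have hV0 : 0 < V := by positivity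
  have hA0 : 0 ≤ A := integral_nonneg fun X => by positivity
  -- `hPφ : A ≤ V⁻¹ m² + c K`, `hPF : 1 ≤ V⁻¹ mF² + c T₀`, `hCS : m² ≤ A (V - mF²)`
  have h1 : V⁻¹ * m ^ 2 ≤ A * (c * T₀) := by
    have h2 : V⁻¹ * m ^ 2 ≤ A * (1 - V⁻¹ * mF ^ 2) := by
      have h3 : A * (1 - V⁻¹ * mF ^ 2) = V⁻¹ * (A * (V - mF ^ 2)) := by
        field_simp
      rw [h3]
      exact mul_le_mul_of_nonneg_left hCS (inv_nonneg.2 hV0.le)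
    exact h2.trans (mul_le_mul_of_nonneg_left (by linarith) hA0)
  have h4 : A ≤ A * (c * T₀) + c * K := by linarith
  have hPc : (2 * Real.pi / L) ^ 2 * c = 1 := by
    rw [hc]
    field_simp
  have h5 : (2 * Real.pi / L) ^ 2 * A ≤ A * T₀ + K := by
    calc (2 * Real.pi / L) ^ 2 * A ≤ (2 * Real.pi / L) ^ 2 * (A * (c * T₀) + c * K) :=
          mul_le_mul_of_nonneg_left h4 (sq_nonneg _)
      _ = (2 * Real.pi / L) ^ 2 * c * (A * T₀ + K) := by ring
      _ = A * T₀ + K := by rw [hPc, one_mul]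
  have h6 : ((2 * Real.pi / L) ^ 2 - T₀) * A = (2 * Real.pi / L) ^ 2 * A - A * T₀ := by ring
  rw [h6]
  linarith

/-! ### The registered stub -/

/-- **`WeightedGap` (registered stub `stub_weightedGap` of the few-body layer).** For a measurable pair
profile `w`, a positive real finite-energy minimiser `Φ` of `E_w` over the finite-energy periodic trial
states (value `λ = E_w(Φ)`) and a real `C¹` lattice-periodic Bose-symmetric `η` with `∫ η|Φ|² = 0`:
`((2π/L)² − 2λ) ∫ η²|Φ|² ≤ 𝓔_{|Φ|}(η, η)`.
Proof: the unnormalised ground-state representation `∫|∇(η|Φ|)|² + ∫Wη²|Φ|² = λ∫η²|Φ|² + 𝓔_{|Φ|}(η,η)`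
(`gradDot_mul_self_eq`, `eulerLagrange_of_isMinimiser` with `s = 0`, `ζ = η²`), `W ≥ 0`,
`∫|∇|Φ||² ≤ λ`, and the Poincaré–Cauchy–Schwarz core `integral_gradDot_mul_ge`.
[cite: Davies1989, §4.2 Thm 4.2.1 (proof), pp. 109–110] -/
theorem stub_weightedGap :
    ∀ (w : ℝ → ℝ≥0∞), Measurable w → ∀ (N : ℕ) (L : ℝ), 0 < L →
      ∀ Φ : PeriodicTrialState N L, (∀ X, Φ.ψ X = (‖Φ.ψ X‖ : ℂ)) → (∀ X, Φ.ψ X ≠ 0) →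
        periodicEnergy w Φ ≠ ⊤ →
        (∀ Ψ : PeriodicTrialState N L, periodicEnergy w Ψ ≠ ⊤ →
          (periodicEnergy w Φ).toReal ≤ (periodicEnergy w Ψ).toReal) →
        ∀ η : Config N → ℝ, IsPeriodicTest L η →
          (∀ (σ : Equiv.Perm (Fin N)) (X : Config N), η (X ∘ σ) = η X) →
          (∫ X in cellN N L, η X * ‖Φ.ψ X‖ ^ 2) = 0 →
          ((2 * Real.pi / L) ^ 2 - 2 * (periodicEnergy w Φ).toReal) *
              ∫ X in cellN N L, η X ^ 2 * ‖Φ.ψ X‖ ^ 2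
            ≤ dirichletFormW L (fun X => ‖Φ.ψ X‖) η η := by
  intro w hw N L hL Φ hreal hpos hfin hmin η hη hηsymm horth
  have hF : ContDiff ℝ 1 (fun X => ‖Φ.ψ X‖) := contDiff_norm_of_real Φ hreal
  have hFper : IsLatticePeriodic L (fun X => ‖Φ.ψ X‖) := fun X i a => by
    simp only [Φ.periodic X i a]
  have hηC : ContDiff ℝ 1 η := hη.1
  have hηper : IsLatticePeriodic L η := hη.2
  -- (1) the weak Euler–Lagrange equation with `s = 0`, tested with `ζ = η²`
  have hmin0 : ∀ Ψ : PeriodicTrialState N L, periodicEnergy w Ψ ≠ ⊤ →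
      (periodicEnergy w Φ).toReal + 0 * cosMean L 0 Φ ≤
        (periodicEnergy w Ψ).toReal + 0 * cosMean L 0 Ψ := fun Ψ hΨ => by
    simpa only [zero_mul, add_zero] using hmin Ψ hΨ
  have hζ : ContDiff ℝ 1 fun X => η X ^ 2 := hηC.pow 2
  have hζper : IsLatticePeriodic L fun X => η X ^ 2 := fun X i a => by
    show η _ ^ 2 = η X ^ 2
    rw [hηper X i a]
  have hζsymm : ∀ (σ : Equiv.Perm (Fin N)) (X : Config N),
      (fun X => η X ^ 2) (X ∘ σ) = (fun X => η X ^ 2) X := fun σ X => by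
    simp only [hηsymm σ X]
  have hEL := eulerLagrange_of_isMinimiser hL hw hreal hpos hfin 0 0 hmin0 hζ hζper hζsymm
  simp only [zero_mul, add_zero] at hEL
  -- (2) the `C¹` ground-state identity `|∇(ηF)|² = ∇F·∇(η²F) + |∇η|²F²`, integrated
  have hkin : ∫ X in cellN N L, gradDot (fun Y => η Y * ‖Φ.ψ Y‖) (fun Y => η Y * ‖Φ.ψ Y‖) X =
      (∫ X in cellN N L, gradDot (fun Y => ‖Φ.ψ Y‖) (fun Y => η Y ^ 2 * ‖Φ.ψ Y‖) X) +
        dirichletFormW L (fun X => ‖Φ.ψ X‖) η η := by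
    unfold dirichletFormW
    rw [← integral_add (integrableOn_cellN (continuous_gradDot hF (hζ.mul hF)) L)
      (integrableOn_gradDot_mul_sq hF.continuous hηC hηC L)]
    refine integral_congr_ae (ae_of_all _ fun X => ?_)
    exact gradDot_mul_self_eq (hηC.differentiable one_ne_zero X) (hF.differentiable one_ne_zero X)
  -- (3) the interaction term is nonnegative
  have hW : 0 ≤ ∫ X in cellN N L, (periodicInteraction w L X).toReal * η X ^ 2 * ‖Φ.ψ X‖ ^ 2 :=
    integral_nonneg fun X => by positivity
  -- (4) the kinetic energy of the ground state is at most `λ`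
  have hΦ1 : ∀ X, Φ.ψ X = (((1 : ℝ) * ‖Φ.ψ X‖ : ℝ) : ℂ) := fun X => by
    rw [one_mul]; exact hreal X
  have hT0 : ∫ X in cellN N L, gradDot (fun Y => ‖Φ.ψ Y‖) (fun Y => ‖Φ.ψ Y‖) X ≤
      (periodicEnergy w Φ).toReal := by
    have h0 : 0 ≤ ∫ X in cellN N L, (periodicInteraction w L X).toReal * ‖Φ.ψ X‖ ^ 2 :=
      integral_nonneg fun X => mul_nonneg ENNReal.toReal_nonneg (sq_nonneg _)
    rw [toReal_periodicEnergy_of_eq_mul hw hreal hpos hfin Φ contDiff_const hΦ1]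
    simp only [one_mul]
    linarith
  -- (5) the Poincaré–Cauchy–Schwarz core and (6) the assembly
  have hcore := integral_gradDot_mul_ge hL hF hFper hηC hηper (integral_norm_sq_eq_one Φ) horth
  have hA0 : 0 ≤ ∫ X in cellN N L, η X ^ 2 * ‖Φ.ψ X‖ ^ 2 := integral_nonneg fun X => by positivity
  have hTA := mul_le_mul_of_nonneg_right hT0 hA0
  nlinarith [hkin, hEL, hW, hcore, hTA]

end Summit.AtomisticToContinuum.BoseEinsteinCondensation.Cruxes.StaticResponseBound.FewBody

end
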